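import Summits.BirchSwinnertonDyer.BirchSwinnertonDyer.Theorems.CMKolyvaginAtInertTwoInertOrderSplittingSelmer
import Literature.NumberTheory.EllipticCurves.IsogenyGroundFieldExtensionProofs
import Literature.NumberTheory.EllipticCurves.IsogenyGeomEndRingProofs
import Literature.NumberTheory.EllipticCurves.ComplexMultiplicationHasCMProofs
import Literature.NumberTheory.EllipticCurves.ShaIsogenyProofs
import HarnessLib

/-!
# `P2` typed interface (cell `bsd-print-cf2`, seat ty2): the CM generator of the inert-order
# splitting IS A `K`-ISOGENY — discharge of the binder `hloc` («`η` has local points maps») of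
# `InertOrderSplittingHabitat.natCard_selmer_eq_sq_of_hasLocalPointsMaps` (MEMO §5 stub S1)

Route `CMKolyvaginAtInertTwo`, crux `CMKolyvaginExactAtInertTwo` (stmt-BirchSwinnertonDyer-24277),
KERNEL-STATUS v9 §9 «WHAT REMAINS (d): `η_*` preserves `Sel_{2^M}(E/L)` — needs `η` as an `L`-rational
isogeny acting on local points». THEOREMS ONLY (0 defs / 0 facts / 0 sorry); no item is closed.

cmk2's chain produces the equivariant CM generator `η` on `E_K(K̄)` EXISTENTIALLY, as an abstract
additive endomorphism, so its Selmer file displays «`η` has local points maps» as the binder `hloc`.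
Here the generator is REBUILT AS A TERM OF `WeierstrassCurve.Isogeny (W⁄K) (W⁄K)`:
* §1 `commute_absGaloisRestrict_of_dichotomy` (η₀ with `η₀² + mη₀ = c`, `m, c` odd, + dichotomy
  commutes with `γ|_{ℚ̄}`, `γ ∈ Γ_K`, when `Δ_{E_K} ∈ K^{×2}`: even action on `E[2]` read through the
  explicit transport), `exists_cmIsogeny_baseChange_of_dichotomy` (if `η₀` is ALGEBRAIC its transport is
  an isogeny `E_K → E_K` DEFINED OVER `K`: ty2's Literature `exists_isogeny_baseChange_of_isAlgebraicOn`).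
* §2 `exists_cmIsogeny_baseChange_of_mem_maximalCMJInvariants` (six maximal inert orders; Cox's
  generator is algebraic by `mem_geomEndRing_iff_holds`, non-zero as it kills no `2`-torsion point).
* §3 `j = −12288000`: cmk2's `η₀ = e⁻¹ψωφe` is ALGEBRAIC (`IsAlgebraicOn.comp`,
  `isAlgebraicOn_twistPointsIso[_symm]`) ⟹ `exists_cmIsogeny_baseChange_of_j_eq_neg_12288000`.
* §4 `exists_cmIsogeny_baseChange_of_cmInert_two` — the ALL-`H₂` door:
  `∃ k₀ c (η : Isogeny (W⁄K) (W⁄K)), Odd c ∧ η² + (2k₀+1)η = c` for every number field `K ∋ √d_F`.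
Sibling `CMKolyvaginCMIsogenyAtTwoSelmer.lean`: `η_*` preserves `Sel_{2^M}(E_K/K)` and
`#Sel = (#Sel^{σ})²` on `H₂` with NO `hloc` binder. (The binder as displayed — for ALL abstract
equivariant `η` — is not dischargeable: such an `η` need not be algebraic; the route needs the produced one.)

beyond-print theorem: NO (Silverman *AEC* I.§3 Ex. 1.12(c), III.§4; Lang Ch. 10 §4 Remark). BSD is not
proved by any of this; no summit statement is proved by this seat.
References: Silverman *AEC* (2009) I.§3, III.§4, III.§6 [SilvermanAEC2009]; Lang, *Elliptic Functions*
(1987) Ch. 10 §4 [Lang1987]; Cox (2013) §14 [Cox2013]; Cremona, *Algorithms* (1997) §3.8 [CremonaAlgorithms1997].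
-/

set_option autoImplicit false

noncomputable section

open scoped Classical

namespace Summit.BirchSwinnertonDyer.Rank1Residual.P2.CMIsogenyAtTwo

open WeierstrassCurve Field
open Literature.NumberTheory.EllipticCurves Literature.NumberTheory.EllipticCurves.Rank1Residual
open Literature.NumberTheory.GaloisRepresentations
open Summit.BirchSwinnertonDyer.Rank1Residual Summit.BirchSwinnertonDyer.Rank1Residual.P2
open Summit.BirchSwinnertonDyer.Rank1Residual.P2.CartanAtTwo
open Summit.BirchSwinnertonDyer.BirchSwinnertonDyer.Theorems.KolyvaginEigenTwo
open Summit.BirchSwinnertonDyer.BirchSwinnertonDyer.Theorems.InertOrderSplittingHabitat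

universe u

/-! ## §1 From an algebraic generator with the dichotomy over `ℚ` to a `K`-isogeny -/

section Dichotomy

variable (W : WeierstrassCurve ℚ) [W.IsElliptic]

/-- **A CM generator commutes with `Γ_K` for `K ∋ √Δ_E`, on `E(ℚ̄)`.** Let `η₀` on `E(ℚ̄)` satisfy
`η₀² + mη₀ = c` with `m, c` odd and the Galois dichotomy (every `γ ∈ Γ_ℚ` commutes with `η₀` or
conjugates it to `η̄₀ = −η₀ − m`), and let `K` be a number field with `Δ_{E_K} ∈ K^{×2}`. Then
`η₀ (γ|_{ℚ̄} P) = γ|_{ℚ̄} (η₀ P)` for every `γ ∈ Γ_K`: `γ` is even on `E_K[2]`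
(`smul_trivial_or_fixedPointFree_of_isSquare_Δ`), read on `E[2](ℚ̄)` through the injective equivariant
transport `E(ℚ̄) → E_K(K̄)`, and even elements commute (`commute_of_trivial`, `commute_of_fixedPointFree`).
[cite: Lang1987, Ch. 10 §4, Remark] -/
theorem commute_absGaloisRestrict_of_dichotomy {η₀ : AddMonoid.End (geomPoints W)} {m c : ℤ}
    (hrel : ∀ P : geomPoints W, η₀ (η₀ P) + m • η₀ P = c • P) (hm : Odd m) (hc : Odd c)
    (hdich : ∀ γ : absoluteGaloisGroup ℚ, (∀ P : geomPoints W, γ • η₀ P = η₀ (γ • P)) ∨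
      (∀ P : geomPoints W, η₀ (γ • P) = -(γ • η₀ P) - m • γ • P))
    (K : Type) [Field K] [NumberField K] (hΔ : IsSquare (W.baseChange K).Δ)
    (γ : absoluteGaloisGroup K) (P : geomPoints W) :
    η₀ (absGaloisRestrict ℚ K γ • P) = absGaloisRestrict ℚ K γ • η₀ P := by
  haveI : (W.baseChange K).IsElliptic := by rw [baseChange]; infer_instance
  have hcard : Nat.card (geomTorsion W ((2 : ℕ) : ℤ)) = 4 := by
    simpa using natCard_geomTorsion_two_pow W 1
  have h2K : (2 : K) ≠ 0 := two_ne_zero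
  -- the transport `e : E(ℚ̄) → E_K(K̄)`: injective, additive, equivariant along `res`
  have einj : Function.Injective fun R : geomPoints W ↦
      localPointsEquivGeomPoints W K (pointsMapOfEmb W (absClosureEmbedding ℚ K) R) :=
    (localPointsEquivGeomPoints W K).injective.comp (pointsMapOfEmb_injective W _)
  have he2 : ∀ R : geomPoints W, (2 : ℤ) • R = 0 →
      (2 : ℤ) • localPointsEquivGeomPoints W K (pointsMapOfEmb W (absClosureEmbedding ℚ K) R) = 0 :=
    fun R h2R ↦ by rw [← map_zsmul, ← map_zsmul, h2R, map_zero, map_zero]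
  symm
  rcases smul_trivial_or_fixedPointFree_of_isSquare_Δ (W.baseChange K) h2K hΔ γ with htriv | hfpf
  · refine commute_of_trivial hm hcard (hdich _) (fun R h2R ↦ ?_) P
    apply einj
    change localPointsEquivGeomPoints W K
        (pointsMapOfEmb W (absClosureEmbedding ℚ K) (absGaloisRestrict ℚ K γ • R)) =
      localPointsEquivGeomPoints W K (pointsMapOfEmb W (absClosureEmbedding ℚ K) R)
    rw [localPointsEquivGeomPoints_pointsMapOfEmb_smul, htriv _ (he2 R h2R)]
  · refine commute_of_fixedPointFree hrel hm hc hcard (hdich _) (fun R h2R hfix ↦ ?_) P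
    have h0 : localPointsEquivGeomPoints W K (pointsMapOfEmb W (absClosureEmbedding ℚ K) R) = 0 :=
      hfpf _ (he2 R h2R) (by rw [← localPointsEquivGeomPoints_pointsMapOfEmb_smul, hfix])
    apply einj
    change localPointsEquivGeomPoints W K (pointsMapOfEmb W (absClosureEmbedding ℚ K) R) =
      localPointsEquivGeomPoints W K (pointsMapOfEmb W (absClosureEmbedding ℚ K) 0)
    rw [h0]
    simp only [map_zero]

/-- **An ALGEBRAIC CM generator over `ℚ̄` with the dichotomy is a `K`-ISOGENY of `E_K` for `K ∋ √Δ_E`.**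
Let `η₀ : E(ℚ̄) →+ E(ℚ̄)` be algebraic (given by a rational map off a finite set), with
`η₀² + mη₀ = c`, `m, c` odd, and the Galois dichotomy; let `K` be a number field with `Δ_{E_K} ∈ K^{×2}`.
Then there is an isogeny `η : E_K → E_K` DEFINED OVER `K` — a term of `Isogeny (W⁄K) (W⁄K)` — which is
the transport of `η₀` along `E(ℚ̄) ≃ E_K(K̄)` and satisfies `η² + mη = c` on `E_K(K̄)`
(ty2's `WeierstrassCurve.exists_isogeny_baseChange_of_isAlgebraicOn` with §1's commutation; the kernel
is finite because `η₀` is algebraic, `IsAlgebraicOn.finite_ker`).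
[cite: SilvermanAEC2009, I.§3 Ex. 1.12(c) and III.§4] [cite: Lang1987, Ch. 10 §4, Remark] -/
theorem exists_cmIsogeny_baseChange_of_dichotomy {η₀ : AddMonoid.End (geomPoints W)} {m c : ℤ}
    (halg : IsAlgebraicOn W W η₀)
    (hrel : ∀ P : geomPoints W, η₀ (η₀ P) + m • η₀ P = c • P) (hm : Odd m) (hc : Odd c)
    (hdich : ∀ γ : absoluteGaloisGroup ℚ, (∀ P : geomPoints W, γ • η₀ P = η₀ (γ • P)) ∨
      (∀ P : geomPoints W, η₀ (γ • P) = -(γ • η₀ P) - m • γ • P))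
    (K : Type) [Field K] [NumberField K] (hΔ : IsSquare (W.baseChange K).Δ) :
    ∃ η : Isogeny (W.baseChange K) (W.baseChange K),
      (∀ P : geomPoints W,
        η (localPointsEquivGeomPoints W K (pointsMapOfEmb W (absClosureEmbedding ℚ K) P)) =
          localPointsEquivGeomPoints W K (pointsMapOfEmb W (absClosureEmbedding ℚ K) (η₀ P))) ∧
      ∀ Q : geomPoints (W.baseChange K), η (η Q) + m • η Q = c • Q := by
  obtain ⟨η, hη⟩ := exists_isogeny_baseChange_of_isAlgebraicOn K W W η₀ halg
    (commute_absGaloisRestrict_of_dichotomy W hrel hm hc hdich K hΔ) halg.finite_ker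
  exact ⟨η, hη, rel_transport_baseChange K W (g := η.toAddMonoidHom) hη hrel⟩

end Dichotomy

/-! ## §2 The six maximal inert orders: Cox's generator over `K ∋ √Δ` as a `K`-isogeny -/

section Maximal

variable (W : WeierstrassCurve ℚ) [W.IsElliptic]

/-- **The CM generator of a maximal order is a `K`-ISOGENY over `K ∋ √Δ_E`.** For `E/ℚ` with `j(E)` one
of the maximal CM invariants, `d = cmDiscr j(E)` odd, `4c = d(d−1)` with `c` odd, and `K` a number field
with `Δ_{E_K} ∈ K^{×2}`: there is an isogeny `η : E_K → E_K` defined over `K` with `η(ηQ) − d·ηQ = −c·Q`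
on `E_K(K̄)`. (Cox's `ι₀(ω_d) ∈ End_{ℚ̄}(E)` is zero or algebraic — `mem_geomEndRing_iff_holds` — and it
is not zero since it kills no non-zero `2`-torsion point; then §1.)
[cite: Cox2013, Thm. 14.16 and §14.B Prop. 14.9] [cite: SilvermanAEC2009, I.§3 Ex. 1.12(c) and III.§4] -/
theorem exists_cmIsogeny_baseChange_of_mem_maximalCMJInvariants (hj : W.j ∈ maximalCMJInvariants)
    {d c : ℤ} (hd : cmDiscr W.j = d) (hc : d * (d - 1) = 4 * c) (hodd : Odd d) (hoddc : Odd c)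
    (K : Type) [Field K] [NumberField K] (hΔ : IsSquare (W.baseChange K).Δ) :
    ∃ η : Isogeny (W.baseChange K) (W.baseChange K),
      ∀ Q : geomPoints (W.baseChange K), η (η Q) + (-d) • η Q = (-c) • Q := by
  subst hd
  obtain ⟨η₀, hη₀, hrel₀⟩ := exists_cmGenerator_of_mem_maximalCMJInvariants W hj hc
  have hrel : ∀ P : geomPoints W, η₀ (η₀ P) + (-cmDiscr W.j) • η₀ P = (-c) • P := rel_apply W hrel₀
  have hcard : Nat.card (geomTorsion W ((2 : ℕ) : ℤ)) = 4 := by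
    simpa using natCard_geomTorsion_two_pow W 1
  -- `η₀ ≠ 0`: it kills no non-zero `2`-torsion point
  have hne : η₀ ≠ 0 := by
    obtain ⟨Q, hQ, h2Q⟩ := exists_two_torsion_ne_zero hcard
    intro h0
    exact eta_ne_zero hrel hodd.neg hoddc.neg hQ h2Q (by simp [h0])
  have halg : IsAlgebraicOn W W η₀ := ((mem_geomEndRing_iff_holds (W := W) η₀).1 hη₀).resolve_left hne
  obtain ⟨η, -, hrelK⟩ := exists_cmIsogeny_baseChange_of_dichotomy W halg hrel hodd.neg hoddc.neg
    (dichotomy W hη₀ hrel₀) K hΔ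
  exact ⟨η, hrelK⟩

end Maximal

/-! ## §3 The order `ℤ[3ζ₃]` (`j = −12288000`): cmk2's `e⁻¹ψωφe` is algebraic -/

section TwistIso

variable {k : Type u} [Field k] {W₁ W₂ : WeierstrassCurve k} {C : VariableChange k}

/-- `C • W₁ = W₂` over `k` gives `C_{k̄} • (W₁)_{k̄} = (W₂)_{k̄}` over `k̄` (`baseChange_smul_eq`). [folklore] -/
theorem map_smul_baseChange_eq_of_smul_eq (hC : C • W₁ = W₂) :
    C.map (algebraMap k (AlgebraicClosure k)) • W₁.baseChange (AlgebraicClosure k) =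
      W₂.baseChange (AlgebraicClosure k) := by
  rw [← VariableChange.baseChange_smul_eq, hC]

/-- **The tree's `twistPointsIso hC : W₁(k̄) ≃+ W₂(k̄)` IS the substitution isomorphism
`pointEquiv (C_{k̄}) ≫ (transport along C_{k̄} • (W₁)_{k̄} = (W₂)_{k̄})`** of
`ComplexMultiplicationHasCMProofs` (both are `(x, y) ↦ (u⁻²(x − r), u⁻³(y − s(x − r) − t))` on affine
points and `O ↦ O`). [cite: SilvermanAEC2009, III.1 Table 3.1] -/
theorem twistPointsIso_eq_pointEquiv_trans_congrEquiv (hC : C • W₁ = W₂) :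
    twistPointsIso hC =
      (VariableChange.pointEquiv (W₁.baseChange (AlgebraicClosure k))
          (C.map (algebraMap k (AlgebraicClosure k)))).trans
        (Affine.Point.congrEquiv (map_smul_baseChange_eq_of_smul_eq hC)) := by
  ext P
  rcases P with _ | ⟨x, y, h⟩
  · change twistPointsIso hC 0 =
      ((VariableChange.pointEquiv (W₁.baseChange (AlgebraicClosure k))
          (C.map (algebraMap k (AlgebraicClosure k)))).trans
        (Affine.Point.congrEquiv (map_smul_baseChange_eq_of_smul_eq hC))) 0
    rw [map_zero, map_zero]
    rfl
  · obtain ⟨h', e'⟩ := twistPointsIso_some hC h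
    exact e'.trans (pointEquiv_trans_congrEquiv_some (C.map (algebraMap k (AlgebraicClosure k)))
      (map_smul_baseChange_eq_of_smul_eq hC) h).symm

/-- **A `k`-isomorphism of models is an algebraic map of geometric points**: the tree's
`twistPointsIso hC : W₁(k̄) ≃+ W₂(k̄)` (`C • W₁ = W₂`) is, on points, the substitution
`(x, y) ↦ (u⁻²(x − r), u⁻³(y − s(x − r) − t))` with the coefficients of `C` viewed in `k̄`
(`isAlgebraicOn_pointEquiv_trans_congrEquiv`). [cite: SilvermanAEC2009, III.1 Table 3.1] -/
theorem isAlgebraicOn_twistPointsIso (hC : C • W₁ = W₂) :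
    IsAlgebraicOn W₁ W₂ (twistPointsIso hC) := by
  rw [twistPointsIso_eq_pointEquiv_trans_congrEquiv hC]
  exact isAlgebraicOn_pointEquiv_trans_congrEquiv (C.map (algebraMap k (AlgebraicClosure k)))
    (map_smul_baseChange_eq_of_smul_eq hC)

/-- The inverse `k`-isomorphism `W₂(k̄) → W₁(k̄)` is algebraic as well
(`isAlgebraicOn_pointEquiv_trans_congrEquiv_symm`). [cite: SilvermanAEC2009, III.1 Table 3.1] -/
theorem isAlgebraicOn_twistPointsIso_symm (hC : C • W₁ = W₂) :
    IsAlgebraicOn W₂ W₁ (twistPointsIso hC).symm := by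
  rw [twistPointsIso_eq_pointEquiv_trans_congrEquiv hC]
  exact isAlgebraicOn_pointEquiv_trans_congrEquiv_symm (C.map (algebraMap k (AlgebraicClosure k)))
    (map_smul_baseChange_eq_of_smul_eq hC)

end TwistIso

section NonMaximal

/-- **An ALGEBRAIC CM generator with its dichotomy for `j(E) = −12288000`.** cmk2's construction
(`exists_cmGenerator_of_j_eq_neg_12288000`): `E ≅_ℚ E_d = [0, 36d, 0, −48d², 16d³]` (`e`), Vélu's
`3`-isogeny `φ : E_d → E'_d` (`j = 0`), its dual `ψ` (`ψφ = 3`), Cox's `ω` on `E'_d` (`ω² + 3ω = −3`);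
`η₀ = e⁻¹ ψ ω φ e` satisfies `η₀² + 9η₀ = −27` and the dichotomy — AND `η₀` is ALGEBRAIC, being a
composite of algebraic additive maps (`IsAlgebraicOn.comp`: `e`, `e⁻¹` by `isAlgebraicOn_twistPointsIso[_symm]`,
`φ`, `ψ` isogenies, `ω` by `mem_geomEndRing_iff_holds`).
[cite: Lang1987, Ch. 10 §4, Remark] [cite: CremonaAlgorithms1997, §3.8 (Vélu's formulae)]
[cite: SilvermanAEC2009, III.§4 (End(E) = Hom(E,E) under composition)] -/
theorem exists_algebraic_cmGenerator_dichotomy_of_j_eq_neg_12288000 (W : WeierstrassCurve ℚ)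
    [W.IsElliptic] (hj : W.j = -12288000) :
    ∃ η₀ : AddMonoid.End (geomPoints W), IsAlgebraicOn W W η₀ ∧
      (∀ P : geomPoints W, η₀ (η₀ P) + (9 : ℤ) • η₀ P = (-27 : ℤ) • P) ∧
      ∀ γ : absoluteGaloisGroup ℚ, (∀ P : geomPoints W, γ • η₀ P = η₀ (γ • P)) ∨
        (∀ P : geomPoints W, η₀ (γ • P) = -(γ • η₀ P) - (9 : ℤ) • γ • P) := by
  -- the reference model `E₁ = [0, 36, 0, -48, 16]`, `j = -12288000`
  haveI hE₁ : (⟨0, 36, 0, -48, 16⟩ : WeierstrassCurve ℚ).IsElliptic :=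
    ⟨isUnit_iff_ne_zero.mpr (by
      norm_num [WeierstrassCurve.Δ, WeierstrassCurve.b₂, WeierstrassCurve.b₄, WeierstrassCurve.b₆,
        WeierstrassCurve.b₈])⟩
  have hjE₁ : (⟨0, 36, 0, -48, 16⟩ : WeierstrassCurve ℚ).j = -12288000 := by
    rw [j, Units.inv_mul_eq_iff_eq_mul, coe_Δ']
    norm_num [WeierstrassCurve.c₄, WeierstrassCurve.Δ, WeierstrassCurve.b₂, WeierstrassCurve.b₄,
      WeierstrassCurve.b₆, WeierstrassCurve.b₈]
  obtain ⟨d, hd, C, hC⟩ := exists_variableChange_eq_quadraticTwist_of_j_eq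
    (W := W) (E := (⟨0, 36, 0, -48, 16⟩ : WeierstrassCurve ℚ)) (by rw [hj, hjE₁])
    (by rw [hjE₁]; norm_num) (by rw [hjE₁]; norm_num)
  have hV : (⟨0, 36, 0, -48, 16⟩ : WeierstrassCurve ℚ).quadraticTwist d =
      ⟨0, 36 * d, 0, -48 * d ^ 2, 16 * d ^ 3⟩ := by
    ext <;> simp [WeierstrassCurve.quadraticTwist, WeierstrassCurve.b₂, WeierstrassCurve.b₄,
      WeierstrassCurve.b₆] <;> ring
  rw [hV] at hC
  set V : WeierstrassCurve ℚ := ⟨0, 36 * d, 0, -48 * d ^ 2, 16 * d ^ 3⟩ with hVdef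
  have hΔV : V.Δ = -995328 * d ^ 6 := by
    simp only [hVdef, WeierstrassCurve.Δ, WeierstrassCurve.b₂, WeierstrassCurve.b₄,
      WeierstrassCurve.b₆, WeierstrassCurve.b₈]
    ring
  have hΔV0 : V.Δ ≠ 0 := by rw [hΔV]; exact mul_ne_zero (by norm_num) (pow_ne_zero 6 hd)
  haveI hVell : V.IsElliptic := ⟨isUnit_iff_ne_zero.mpr hΔV0⟩
  have hpair : IsKernelXThreePair (36 * d) (-48 * d ^ 2) (16 * d ^ 3) V
      (kernelXThreeCodomain (36 * d) (-48 * d ^ 2) (16 * d ^ 3)) :=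
    isKernelXThreePair_mk (by ring) hΔV0
  set V' : WeierstrassCurve ℚ := kernelXThreeCodomain (36 * d) (-48 * d ^ 2) (16 * d ^ 3) with hV'def
  haveI hV'ell : V'.IsElliptic := ⟨isUnit_iff_ne_zero.mpr hpair.Δ'_ne⟩
  have hc4 : V'.c₄ = 0 := by
    simp only [hV'def, WeierstrassCurve.c₄, WeierstrassCurve.b₂, WeierstrassCurve.b₄,
      kernelXThreeCodomain_a₁, kernelXThreeCodomain_a₂, kernelXThreeCodomain_a₃,
      kernelXThreeCodomain_a₄]
    ring
  have hjV' : V'.j = 0 := by rw [j, hc4]; ring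
  -- Cox's generator `ω` on `V'` (`j = 0`, `d = -3`, `c = 3`): `ω² + 3ω = -3`, algebraic
  obtain ⟨ω, hω, hωrel⟩ := exists_cmGenerator_of_mem_maximalCMJInvariants V'
    (by rw [hjV']; simp [maximalCMJInvariants]) (c := 3) (by rw [hjV']; norm_num [cmDiscr])
  have hdV' : cmDiscr V'.j = -3 := by rw [hjV']; norm_num [cmDiscr]
  rw [hdV'] at hωrel
  have hrel' : ∀ Q : geomPoints V', ω (ω Q) + (3 : ℤ) • ω Q = (-3 : ℤ) • Q := by
    have h := rel_apply V' hωrel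
    simpa using h
  have hcardV' : Nat.card (geomTorsion V' ((2 : ℕ) : ℤ)) = 4 := by
    simpa using natCard_geomTorsion_two_pow V' 1
  have hω0 : ω ≠ 0 := by
    obtain ⟨Q, hQ, h2Q⟩ := exists_two_torsion_ne_zero hcardV'
    intro h0
    exact eta_ne_zero hrel' (by decide) (by decide) hQ h2Q (by simp [h0])
  have hωalg : IsAlgebraicOn V' V' ω := ((mem_geomEndRing_iff_holds (W := V') ω).1 hω).resolve_left hω0
  -- Vélu's isogeny and its dual
  set φ := hpair.toIsogeny with hφ
  have hdeg : φ.degree = 3 := by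
    rw [hφ]; exact hpair.natCard_ker_toIsogeny
  obtain ⟨ψ, hψ⟩ := Isogeny.exists_dual_of_isElliptic φ
  have hψφ : ∀ P : geomPoints V, ψ (φ P) = (3 : ℤ) • P := fun P ↦ by
    rw [hψ, hdeg]; norm_cast
  -- `η_V = ψ ω φ` on `V`, then transport to `W` along `C : W ≅ V`
  set e := twistPointsIso hC with hedef
  refine ⟨(e.symm : geomPoints V →+ geomPoints W).comp
      ((ψ.toAddMonoidHom.comp (ω.comp φ.toAddMonoidHom)).comp (e : geomPoints W →+ geomPoints V)),
    ?_, fun P ↦ ?_, fun γ ↦ ?_⟩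
  · -- ALGEBRAIC: composite of algebraic additive maps
    have h1 := IsAlgebraicOn.comp (W := W) (W' := V) (W'' := V') (f := φ.toAddMonoidHom)
      (g := (e : geomPoints W →+ geomPoints V)) φ.isAlgebraic (isAlgebraicOn_twistPointsIso hC)
    have h2 := IsAlgebraicOn.comp (W := W) (W' := V') (W'' := V')
      (f := (ω : geomPoints V' →+ geomPoints V'))
      (g := φ.toAddMonoidHom.comp (e : geomPoints W →+ geomPoints V)) hωalg h1
    have h3 := IsAlgebraicOn.comp (W := W) (W' := V') (W'' := V) (f := ψ.toAddMonoidHom)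
      (g := (ω : geomPoints V' →+ geomPoints V').comp
        (φ.toAddMonoidHom.comp (e : geomPoints W →+ geomPoints V))) ψ.isAlgebraic h2
    exact IsAlgebraicOn.comp (W := W) (W' := V) (W'' := W)
      (f := (e.symm : geomPoints V →+ geomPoints W))
      (g := (ψ.toAddMonoidHom.comp (ω.comp φ.toAddMonoidHom)).comp (e : geomPoints W →+ geomPoints V))
      (isAlgebraicOn_twistPointsIso_symm hC) h3
  · have h := rel_of_addEquiv e (η := ψ.toAddMonoidHom.comp (ω.comp φ.toAddMonoidHom)) (m := 9) (c := -27)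
      (fun Q ↦ by
        have h' := rel_of_isogeny φ ψ hψφ hrel' Q
        norm_num at h'
        exact h') P
    exact h
  · have h := dichotomy_of_addEquiv e (fun γ' P ↦ twistPointsIso_smul hC γ' P)
      (η := ψ.toAddMonoidHom.comp (ω.comp φ.toAddMonoidHom)) (m := 9) (γ := γ)
      (by
        have h' := dichotomy_of_isogeny φ ψ hψφ (γ := γ) (dichotomy V' hω hωrel γ)
        norm_num at h'
        exact h')
    exact h

/-- **The CM generator for `j = −12288000` is a `K`-ISOGENY over `K ∋ √Δ_E`**, with `η² + 9η = −27` on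
`E_K(K̄)` (§1 applied to the algebraic generator above).
[cite: SilvermanAEC2009, I.§3 Ex. 1.12(c) and III.§4] [cite: Lang1987, Ch. 10 §4, Remark] -/
theorem exists_cmIsogeny_baseChange_of_j_eq_neg_12288000 (W : WeierstrassCurve ℚ) [W.IsElliptic]
    (hj : W.j = -12288000) (K : Type) [Field K] [NumberField K] (hΔ : IsSquare (W.baseChange K).Δ) :
    ∃ η : Isogeny (W.baseChange K) (W.baseChange K),
      ∀ Q : geomPoints (W.baseChange K), η (η Q) + (9 : ℤ) • η Q = (-27 : ℤ) • Q := by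
  obtain ⟨η₀, halg, hrel, hdich⟩ := exists_algebraic_cmGenerator_dichotomy_of_j_eq_neg_12288000 W hj
  obtain ⟨η, -, hrelK⟩ := exists_cmIsogeny_baseChange_of_dichotomy W halg hrel (by decide) (by decide)
    hdich K hΔ
  exact ⟨η, hrelK⟩

end NonMaximal

/-! ## §4 The ALL-`H₂` door -/

section Door

variable (W : WeierstrassCurve ℚ) [W.IsElliptic]

/-- **ON ALL OF `H₂` THE CM GENERATOR IS A `K`-ISOGENY.** For `E/ℚ` with CM, `2` inert in the CM field
`F`, `ρ̄_{E,2}` onto, and `K` a number field containing `√d_F`: there are `k₀, c` with `c` odd and an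
isogeny `η : E_K → E_K` DEFINED OVER `K` with `η(ηQ) + (2k₀+1)·ηQ = c·Q` on `E_K(K̄)` — `2` is inert in
`ℤ[η]`. (`j ≠ −12288000`: §2 on the six maximal inert orders, `4c = d(d−1)`; `j = −12288000`: §3.)
[cite: Lang1987, Ch. 10 §4, Remark] [cite: SilvermanATAEC1994, App. A §3] -/
theorem exists_cmIsogeny_baseChange_of_cmInert_two (hCM : W.HasCM) (hin : CMInert W 2)
    (hsurj : W.HasSurjectiveModNGaloisRep 2) (K : Type) [Field K] [NumberField K]
    (hF : IsSquare (algebraMap ℚ K (cmFieldDiscrOfJ W.j))) :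
    ∃ (k₀ c : ℤ) (η : Isogeny (W.baseChange K) (W.baseChange K)), Odd c ∧
      ∀ Q : geomPoints (W.baseChange K), η (η Q) + (2 * k₀ + 1) • η Q = c • Q := by
  have hΔK : IsSquare (W.baseChange K).Δ :=
    isSquare_Δ_baseChange_of_isSquare_cmFieldDiscr W K hCM hin hsurj hF
  have h54 : W.j ≠ 54000 := fun hj ↦
    InertAtlas.not_hasSurjectiveModNGaloisRep_two_of_j_eq_54000 W hj hsurj
  by_cases hj12 : W.j = -12288000
  · obtain ⟨η, hrel⟩ := exists_cmIsogeny_baseChange_of_j_eq_neg_12288000 W hj12 K hΔK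
    refine ⟨4, -27, η, by decide, fun Q ↦ ?_⟩
    norm_num
    exact hrel Q
  -- the six maximal inert orders
  have main : ∀ {d c : ℤ}, W.j ∈ maximalCMJInvariants → cmDiscr W.j = d → d * (d - 1) = 4 * c →
      Odd d → Odd c →
      ∃ (k₀ c' : ℤ) (η : Isogeny (W.baseChange K) (W.baseChange K)), Odd c' ∧
        ∀ Q : geomPoints (W.baseChange K), η (η Q) + (2 * k₀ + 1) • η Q = c' • Q := by
    intro d c hj hd hcd hodd hoddc
    obtain ⟨η, hrel⟩ :=
      exists_cmIsogeny_baseChange_of_mem_maximalCMJInvariants W hj hd hcd hodd hoddc K hΔK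
    obtain ⟨r, hr⟩ := hodd
    refine ⟨-r - 1, -c, η, hoddc.neg, fun Q ↦ ?_⟩
    rw [show (2 * (-r - 1) + 1 : ℤ) = -d by rw [hr]; ring]
    exact hrel Q
  rcases (cmInert_two_iff_of_hasCM (hcm := hCM)).1 hin with h | h | h | h | h | h
  · rcases X12.j_eq_of_cmFieldDiscrOfJ_eq_neg_three h with hj | hj | hj
    · exact main (d := -3) (c := 3) (by rw [hj]; simp [maximalCMJInvariants])
        (by rw [hj]; norm_num [cmDiscr]) (by norm_num) (by decide) (by decide)
    · exact absurd hj h54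
    · exact absurd hj hj12
  · have hj := X12.j_eq_of_cmFieldDiscrOfJ_eq_neg_eleven h
    exact main (d := -11) (c := 33) (by rw [hj]; simp [maximalCMJInvariants])
      (by rw [hj]; norm_num [cmDiscr]) (by norm_num) (by decide) (by decide)
  · have hj := X12.j_eq_of_cmFieldDiscrOfJ_eq_neg_nineteen h
    exact main (d := -19) (c := 95) (by rw [hj]; simp [maximalCMJInvariants])
      (by rw [hj]; norm_num [cmDiscr]) (by norm_num) (by decide) (by decide)
  · have hj := X12.j_eq_of_cmFieldDiscrOfJ_eq_neg_fortythree h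
    exact main (d := -43) (c := 473) (by rw [hj]; simp [maximalCMJInvariants])
      (by rw [hj]; norm_num [cmDiscr]) (by norm_num) (by decide) (by decide)
  · have hj := X12.j_eq_of_cmFieldDiscrOfJ_eq_neg_sixtyseven h
    exact main (d := -67) (c := 1139) (by rw [hj]; simp [maximalCMJInvariants])
      (by rw [hj]; norm_num [cmDiscr]) (by norm_num) (by decide) (by decide)
  · have hj := X12.j_eq_of_cmFieldDiscrOfJ_eq_neg_onesixtythree h
    exact main (d := -163) (c := 6683) (by rw [hj]; simp [maximalCMJInvariants])
      (by rw [hj]; norm_num [cmDiscr]) (by norm_num) (by decide) (by decide)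

end Door

end Summit.BirchSwinnertonDyer.Rank1Residual.P2.CMIsogenyAtTwo
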